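import Summits.ValiantsHypothesis.ValiantsHypothesis.Theorems.TwistedDetRankSliceVBPFermionicDEvenGadget

/-!
# Crux `TwistedDetRank.SliceVBPFermionic` (stmt-ValiantsHypothesis-17991, X2b) — the layer-switch
# gadget, II: support analysis and the identity `D^even_{4a}(laySubst) = Σ_ρ (-1)^a sgn ρ · N(ρ) · Y^ρ`

Sequel of Theorems/TwistedDetRankSliceVBPFermionicDEvenGadget.lean (the substitution `laySubst` on
`Fin a × (Bool ⊕ Bool)` and the covers `layPerm ρ s`).  Here:

* `exists_layPerm_of_support`: a permutation `τ` all of whose substituted factors are non-zero and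
  whose coefficient `dEvenClass τ` is non-zero IS `layPerm ρ s` for a permutation `ρ` and a
  `2`-colouring `s` of `ρ` — the middle vertex `m_i` forces an entry layer `s i`, the return
  `m'_i → (i, inl b)` to the SAME layer would close the odd `3`-cycle `(i, s i) → m_i → m'_i`
  (`dEvenClass_eq_zero_of_pow_apply_eq_self`), so it goes to the other layer, whose exit edge stays
  in its layer and must hit the entry vertex of its target: `s (ρ i) = ¬ s i`.
* `aeval_laySubst_gmf`: hence `D^even(laySubst) = Σ_ρ (-1)^a · sgn ρ · N(ρ) · Y^ρ` with
  `N(ρ) = #{s : Fin a → Bool | s ∘ ρ = ¬ s}` (`= 2^{c(ρ)} [ρ all-even]`: the right side is `± G_a`,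
  the strategist's even-cycle family; the sequel `…DEvenHard` doubles it onto `± Ferm²`).

HONEST FRAMING.  A gadget identity; complexity consequences in the sequel.  X2b (≥ `VNP ⊄ VBP`)
is neither proved nor refuted; `VP ≠ VNP` is not moved by this item.
References: L. G. Valiant, STOC 1979; S. Mertens, C. Moore, Theory of Computing 9 (2013) §3.
-/

-- single-conjunct layout: Sub = Summit, duplicated namespace component intended
set_option linter.dupNamespace false

noncomputable section

namespace Summit.ValiantsHypothesis.ValiantsHypothesis.Theorems.TwistedDetRankSliceVBPFermionic

open Equiv Equiv.Perm MvPolynomial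
open scoped BigOperators

section LayerGadgetCovers

variable {a : ℕ}

/-! ### Support analysis: every cover with non-zero weight and non-zero coefficient is a `layPerm` -/

/-- Source `m_i`: the only edge out is to `m'_i`. -/
theorem laySubst_apply_mid_ne_zero {τ : Perm (Fin a × (Bool ⊕ Bool))} {i : Fin a}
    (h : laySubst (τ (i, Sum.inr false), (i, Sum.inr false)) ≠ 0) :
    τ (i, Sum.inr false) = (i, Sum.inr true) := by
  rcases hτ : τ (i, Sum.inr false) with ⟨j, b' | c'⟩ <;> rw [hτ] at h
  · simp at h
  · cases c'
    · simp at h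
    · simp only [laySubst_mid'_mid, ne_eq, ite_eq_right_iff, one_ne_zero, imp_false, not_not] at h
      rw [h]

/-- Source `m'_i`: the only edges out are to the two layer vertices of `i`. -/
theorem laySubst_apply_mid'_ne_zero {τ : Perm (Fin a × (Bool ⊕ Bool))} {i : Fin a}
    (h : laySubst (τ (i, Sum.inr true), (i, Sum.inr true)) ≠ 0) :
    ∃ b', τ (i, Sum.inr true) = (i, Sum.inl b') := by
  rcases hτ : τ (i, Sum.inr true) with ⟨j, b' | c'⟩ <;> rw [hτ] at h
  · simp only [laySubst_inl_mid', ne_eq, ite_eq_right_iff, one_ne_zero, imp_false, not_not] at h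
    exact ⟨b', by rw [h]⟩
  · simp at h

/-- Source a layer vertex `(i, inl b)`: the edges out are to `(j, inl b)` (same layer) or `m_i`. -/
theorem laySubst_apply_inl_ne_zero {τ : Perm (Fin a × (Bool ⊕ Bool))} {i : Fin a} {b : Bool}
    (h : laySubst (τ (i, Sum.inl b), (i, Sum.inl b)) ≠ 0) :
    (∃ j, τ (i, Sum.inl b) = (j, Sum.inl b)) ∨ τ (i, Sum.inl b) = (i, Sum.inr false) := by
  rcases hτ : τ (i, Sum.inl b) with ⟨j, b' | c'⟩ <;> rw [hτ] at h
  · simp only [laySubst_inl_inl, ne_eq, ite_eq_right_iff, X_ne_zero, imp_false, not_not] at h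
    exact Or.inl ⟨j, by rw [h]⟩
  · cases c'
    · simp only [laySubst_mid_inl, ne_eq, ite_eq_right_iff, one_ne_zero, imp_false, not_not] at h
      exact Or.inr (by rw [h])
    · simp at h

/-- Target `m_j`: the only edges in are from the two layer vertices of `j`. -/
theorem laySubst_symm_apply_mid_ne_zero {τ : Perm (Fin a × (Bool ⊕ Bool))} {j : Fin a}
    (h : laySubst ((j, Sum.inr false), τ.symm (j, Sum.inr false)) ≠ 0) :
    ∃ b, τ.symm (j, Sum.inr false) = (j, Sum.inl b) := by
  rcases hτ : τ.symm (j, Sum.inr false) with ⟨i, b | c⟩ <;> rw [hτ] at h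
  · simp only [laySubst_mid_inl, ne_eq, ite_eq_right_iff, one_ne_zero, imp_false, not_not] at h
    exact ⟨b, by rw [h]⟩
  · cases c <;> simp at h

/-- **The surviving covers are the `layPerm ρ s` with `s` a `2`-colouring of `ρ`.**  If every
factor of the substituted monomial of `τ` is non-zero and the coefficient `dEvenClass τ` is
non-zero (no odd cycle — this kills the covers returning to the entry layer, which close a
`3`-cycle), then `τ = layPerm ρ s` for a permutation `ρ` and a `2`-colouring `s` of `ρ`.
[folklore] -/
theorem exists_layPerm_of_support (τ : Perm (Fin a × (Bool ⊕ Bool)))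
    (hprod : ∀ v, laySubst (τ v, v) ≠ 0) (hd : dEvenClass τ ≠ 0) :
    ∃ (ρ : Perm (Fin a)) (s : Fin a → Bool), (∀ i, s (ρ i) = !s i) ∧ τ = layPerm ρ s := by
  -- (a) middle vertices
  have hm : ∀ i, τ (i, Sum.inr false) = (i, Sum.inr true) := fun i =>
    laySubst_apply_mid_ne_zero (hprod _)
  -- (d) the entry layer `s i`
  let s : Fin a → Bool := fun i => decide (τ (i, Sum.inl true) = (i, Sum.inr false))
  have he : ∀ i, τ (i, Sum.inl (s i)) = (i, Sum.inr false) := by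
    intro i
    by_cases ht : τ (i, Sum.inl true) = (i, Sum.inr false)
    · have : s i = true := by simp [s, ht]
      rw [this, ht]
    · have hsi : s i = false := by simp [s, ht]
      rw [hsi]
      have hw := hprod (τ.symm (i, Sum.inr false))
      rw [Equiv.apply_symm_apply] at hw
      obtain ⟨b, hb⟩ := laySubst_symm_apply_mid_ne_zero hw
      have hτb : τ (i, Sum.inl b) = (i, Sum.inr false) := by
        rw [← hb, Equiv.apply_symm_apply]
      cases b
      · exact hτb
      · exact absurd hτb ht
  -- (e) the exit layer is the other layer (else a `3`-cycle)
  have hx : ∀ i, τ (i, Sum.inr true) = (i, Sum.inl (!s i)) := by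
    intro i
    obtain ⟨b', hb'⟩ := laySubst_apply_mid'_ne_zero (hprod (i, Sum.inr true))
    rcases Bool.eq_or_eq_not b' (s i) with rfl | rfl
    · exfalso
      apply hd
      apply dEvenClass_eq_zero_of_pow_apply_eq_self (n := 3) (x := (i, Sum.inl (s i))) (by decide)
      rw [pow_succ, pow_two, Perm.mul_apply, Perm.mul_apply, he, hm, hb']
    · exact hb'
  -- (f) the exit edge stays in its layer
  have hg : ∀ i, ∃ j, τ (i, Sum.inl (!s i)) = (j, Sum.inl (!s i)) := by
    intro i
    rcases laySubst_apply_inl_ne_zero (hprod (i, Sum.inl (!s i))) with h | h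
    · exact h
    · exfalso
      have := (he i).symm ▸ h
      have hb := congrArg Prod.snd (τ.injective this)
      simp at hb
  choose g hg using hg
  -- (g) `g` is injective
  have hginj : Function.Injective g := by
    intro i i' hii'
    by_cases hsi : s i = s i'
    · have h1 := hg i
      rw [hsi, hii', ← hg i'] at h1
      have := congrArg Prod.fst (τ.injective h1)
      exact this
    · exfalso
      have hx' := hx (g i)
      rcases Bool.eq_or_eq_not (s (g i)) (s i) with hc | hc
      · -- `! s (g i) = ! s i`
        rw [hc, ← hg i] at hx'
        exact absurd (congrArg Prod.snd (τ.injective hx')) (by simp)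
      · have hc' : s (g i) = s i' := by
          rw [hc]; cases h3 : s i <;> cases h4 : s i' <;> simp_all
        rw [hc', hii', ← hg i'] at hx'
        exact absurd (congrArg Prod.snd (τ.injective hx')) (by simp)
  -- (h) `ρ` and the `2`-colouring property
  let ρ : Perm (Fin a) := Equiv.ofBijective g (Finite.injective_iff_bijective.1 hginj)
  have hρ : ∀ i, ρ i = g i := fun i => rfl
  have hs : ∀ i, s (ρ i) = !s i := by
    intro i
    rw [hρ]
    rcases Bool.eq_or_eq_not (s (g i)) (s i) with hc | hc
    · exfalso
      have hx' := hx (g i)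
      rw [hc, ← hg i] at hx'
      exact absurd (congrArg Prod.snd (τ.injective hx')) (by simp)
    · exact hc
  refine ⟨ρ, s, hs, Equiv.ext fun v => ?_⟩
  -- (i) pointwise comparison
  obtain ⟨i, b | c⟩ := v
  · rcases Bool.eq_or_eq_not b (s i) with rfl | rfl
    · rw [he, layPerm_entry]
    · rw [hg, layPerm_exit ρ s hs, hρ]
  · cases c
    · rw [hm, layPerm_mid]
    · rw [hx, layPerm_mid']

/-! ## §3 The identity `D^even_{4a}(laySubst) = Σ_ρ (-1)^a sgn ρ · N(ρ) · Y^ρ` -/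

/-- **The layer-switch gadget.**  Substituting `laySubst` into the GMF of `dEvenClass` on
`Fin a × (Bool ⊕ Bool)` leaves the GMF on `Fin a` of
`ρ ↦ (-1)^a · sgn ρ · #{s : Fin a → Bool | s ∘ ρ = ¬ s}` (the number of `2`-colourings of the
cycles of `ρ`: `2^{c(ρ)}` if all cycles of `ρ` are even, else `0`). [folklore] -/
theorem aeval_laySubst_gmf (a : ℕ) :
    aeval laySubst (∑ τ : Perm (Fin a × (Bool ⊕ Bool)), C (dEvenClass τ) *
        ∏ v, (X (τ v, v) : MvPolynomial ((Fin a × (Bool ⊕ Bool)) × (Fin a × (Bool ⊕ Bool))) ℂ)) =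
      ∑ ρ : Perm (Fin a), C ((-1) ^ a * ((Perm.sign ρ : ℤ) : ℂ) *
          (Fintype.card {s : Fin a → Bool // ∀ i, s (ρ i) = !s i} : ℂ)) *
        ∏ i, (X (ρ i, i) : MvPolynomial (Fin a × Fin a) ℂ) := by
  classical
  have hL : aeval laySubst (∑ τ : Perm (Fin a × (Bool ⊕ Bool)), C (dEvenClass τ) *
        ∏ v, (X (τ v, v) : MvPolynomial ((Fin a × (Bool ⊕ Bool)) × (Fin a × (Bool ⊕ Bool))) ℂ)) =
      ∑ τ : Perm (Fin a × (Bool ⊕ Bool)), C (dEvenClass τ) * ∏ v, laySubst (τ v, v) := by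
    simp only [map_sum, map_mul, aeval_C, map_prod, aeval_X, algebraMap_eq]
  rw [hL]
  -- the index set of surviving covers
  set F : Finset (Perm (Fin a) × (Fin a → Bool)) :=
    Finset.univ.filter fun p => ∀ i, p.2 (p.1 i) = !p.2 i with hF
  set emb : Perm (Fin a) × (Fin a → Bool) → Perm (Fin a × (Bool ⊕ Bool)) :=
    fun p => layPerm p.1 p.2 with hemb
  have hinj : Set.InjOn emb F := by
    intro p _ q _ hpq
    obtain ⟨h1, h2⟩ := layPerm_injective_pair hpq
    exact Prod.ext h1 h2
  have hsub : F.image emb ⊆ (Finset.univ : Finset (Perm (Fin a × (Bool ⊕ Bool)))) :=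
    Finset.subset_univ _
  rw [← Finset.sum_subset hsub, Finset.sum_image hinj]
  · -- the surviving terms
    have hterm : ∀ p ∈ F, C (dEvenClass (emb p)) * ∏ v, laySubst (emb p v, v) =
        C ((-1) ^ a * ((Perm.sign p.1 : ℤ) : ℂ)) *
          ∏ i, (X (p.1 i, i) : MvPolynomial (Fin a × Fin a) ℂ) := by
      intro p hp
      have hs : ∀ i, p.2 (p.1 i) = !p.2 i := (Finset.mem_filter.1 hp).2
      rw [hemb]
      simp only
      rw [dEvenClass_layPerm p.1 p.2 hs, prod_laySubst_layPerm p.1 p.2 hs]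
    rw [Finset.sum_congr rfl hterm, hF, Finset.sum_filter, Fintype.sum_prod_type]
    refine Finset.sum_congr rfl fun ρ _ => ?_
    simp only
    rw [← Finset.sum_filter, Finset.sum_const, nsmul_eq_mul, ← Fintype.card_subtype, ← mul_assoc,
      ← map_natCast C, ← map_mul, mul_comm (Fintype.card _ : ℂ)]
  · -- all other covers contribute zero
    intro τ _ hτ
    by_contra hne
    have hd : dEvenClass τ ≠ 0 := by
      intro h0; apply hne; rw [h0, map_zero, zero_mul]
    have hprod : ∀ v, laySubst (τ v, v) ≠ 0 := by
      intro v hv; apply hne; rw [Finset.prod_eq_zero (Finset.mem_univ v) hv, mul_zero]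
    obtain ⟨ρ, s, hs, rfl⟩ := exists_layPerm_of_support τ hprod hd
    exact hτ (Finset.mem_image.2 ⟨(ρ, s), Finset.mem_filter.2 ⟨Finset.mem_univ _, hs⟩, rfl⟩)

end LayerGadgetCovers

end Summit.ValiantsHypothesis.ValiantsHypothesis.Theorems.TwistedDetRankSliceVBPFermionic

end
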